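import Mathlib
import HarnessLib
import Literature.MathematicalPhysics.QuantumLattice.GaugeGroups
import Literature.MathematicalPhysics.QuantumFieldTheory.ConstructiveQFTWave0
import Literature.MathematicalPhysics.QuantumFieldTheory.U1GinibreComparison
import Summits.Ventures.LatticeQCDFlow.Scaling.Conjectures
import Summits.Ventures.LatticeQCDFlow.Scaling.ConjecturesRepaired
import Summits.Ventures.LatticeQCDFlow.Scaling.PlaquetteDecorrelationTwoDimU1

/-!
# LatticeQCDFlow / Scaling — (U′) and (U″) are FALSE in two dimensions (`U(1)`, every `β ≥ 0`): the dimension guard of the repaired items is necessary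

HONEST FRAMING: exact (Metropolis-corrected) sampling algorithms for lattice gauge theory; figures of merit are
autocorrelation/cost numbers at stated couplings and volumes; no continuum-physics claim.

Venture `LatticeQCDFlow` (cell pub-lqcd), topic `Scaling`, FANOUT row 30 (lean-1) — OUR WORK; the negative edge
`d = 2` of the venture's volume-law hypotheses `Conjectures.CrossCutCorrelatorFloor` ((U′), THEORY-2.md §3.1 v1.3)
and `Conjectures.ClusteringFloor` ((U″), v1.6).  Their docstrings and the repaired items
`ConjecturesRepaired.CrossCutCorrelatorFloorR` / `ClusteringFloorR` (guard `3 ≤ d`) SAY that the items fail in two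
dimensions ("plaquettes independent in infinite volume ⇒ the connected correlator is a pure finite-volume effect
there and (U′) FAILS in `d = 2`"); so far the tree refuted only the degenerate plane `i = j`
(`CorrelatorFloorDegenerate.lean`).  This file PROVES the `d = 2` failure for `U(1)` from the uniform
decorrelation of plaquette pairs (`Scaling/PlaquetteDecorrelationTwoDimU1.lean`:
`|Cov_{β,L}(Re U_p, Re U_{p'})| ≤ 4(ρ_{L,2}(β)⁻² − ρ_{L,2}(β)) → 0` for ALL `p ≠ p'`):

* `u1_plaqObs_re_eq` — in `d = 2` the observable `Re tr u1Rep(U_x^{(i,j)})` of every genuine plane `i ≠ j` is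
  `Re U_x` of the `(0,1)`-holonomy (`(1,0)` is the inverse holonomy, same real part);
* **`not_crossCutCorrelatorFloor_two_u1`** — `¬ CrossCutCorrelatorFloor 2 1 U(1) u1Rep β R i j a` for every `β ≥ 0`,
  every cut width `R`, every plane `i ≠ j`, every axis `a` (at volume `L > 2R+1` the two plaquettes are distinct and
  their connected correlator is below any fixed `δ > 0` for `L` large);
* **`not_clusteringFloor_two_u1`** — `¬ ClusteringFloor 2 1 U(1) u1Rep β i j a` for every `β ≥ 0`, `i ≠ j`, `a`
  (the separation `s = 1`, `L ≥ 4`, already fails);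
* `not_crossCutCorrelatorFloorR_two_u1_unguarded`, `not_clusteringFloorR_two_u1_unguarded` — with every OTHER guard
  of the repaired items in force (`i ≠ j`, `0 < β`, a non-constant character `exists_u1_trace_re_ne`) the floors
  still fail in `d = 2`: the guard `3 ≤ d` of `ConjecturesRepaired` is NECESSARY, not hygiene; whereas the repaired
  items themselves hold vacuously in `d = 2` (`crossCutCorrelatorFloorR_two`).

Class (cell rule): MISSTATED-EDGE refutations of the UNREPAIRED items at `d = 2` (the repaired items carry the
guard); no item of any route is closed or changed by this file.  NOT CLAIMED: `β < 0`; non-abelian `G` in `d = 2`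
(same mechanism with the torus constraint `∏_x U_x = [a, b]`; not in the tree); anything in `d ≥ 3`, where (U′)/(U″)
are theorems at strong coupling (`SUNCrossCutFloor`, `U1CrossCutFloorAllT`, `UNCrossCutFloor`,
`ClusteringFloorStrongCoupling`) and conjectures at intermediate `β`.  Literature grade: known physics
(two-dimensional lattice gauge theory is solvable; Migdal 1975, Gross–Witten 1980); new = kernel-checked refutation
of the venture's typed items in `d = 2`.  Elementary given the tree; nothing here is cited as a fact; no `def`,
no `sorry`.
-/

noncomputable section

namespace Summit.Ventures.LatticeQCDFlow.Theory2.Lattice.TwoDim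

open MeasureTheory Filter Topology Literature.MathematicalPhysics.QuantumFieldTheory
open Literature.MathematicalPhysics.QuantumLattice
open Summit.Ventures.LatticeQCDFlow.Theory2.HaarConv
open scoped ENNReal

section U1

variable {L : ℕ}

/-! ## §6. (U′) and (U″) fail in two dimensions -/

/-- In `d = 2` every genuine plane `(i, j)`, `i ≠ j`, carries the observable `Re U_x` of the `(0,1)`-holonomy
(`(1,0)` is the inverse holonomy, with the same real part). [folklore] -/
theorem u1_plaqObs_re_eq {i j : Fin 2} (hij : i ≠ j) (U : GaugeConfig 2 L Circle) (x : Site 2 L) :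
    (u1Rep (plaquetteHolonomy U x i j)).trace.re = ((plaquetteHolonomy U x 0 1 : Circle) : ℂ).re := by
  rw [← trace_u1Rep_re]
  fin_cases i <;> fin_cases j
  · exact absurd rfl hij
  · rfl
  · have h : plaquetteHolonomy U x 1 0 = (plaquetteHolonomy U x 0 1)⁻¹ := by
      unfold plaquetteHolonomy; group
    show (u1Rep (plaquetteHolonomy U x 1 0)).trace.re = _
    rw [h, u1_trace_re_inv]
  · exact absurd rfl hij

/-- `Re : U(1) → ℝ` is measurable and bounded by one. [folklore] -/
theorem measurable_circle_re : Measurable fun z : Circle => ((z : Circle) : ℂ).re := by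
  have hcoe : Continuous fun z : Circle => (z : ℂ) := continuous_subtype_val
  exact (Complex.continuous_re.comp hcoe).measurable

/-- `|Re z| ≤ 1` on the circle. [folklore] -/
theorem abs_circle_re_le_one (z : Circle) : |((z : Circle) : ℂ).re| ≤ 1 :=
  (Complex.abs_re_le_norm _).trans_eq (Circle.norm_coe z)

/-- A non-zero shift of `(ℤ/L)^2` moves every site: `x + c·e_a ≠ x` for `c ≠ 0` in `ℤ/L`. [folklore] -/
theorem ne_add_single {L : ℕ} (x : Site 2 L) (a : Fin 2) {n : ℕ} (hn0 : 0 < n) (hnL : n < L) :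
    x ≠ x + Pi.single a ((n : ℕ) : ZMod L) := by
  intro h
  have h1 : (Pi.single a ((n : ℕ) : ZMod L) : Site 2 L) = 0 := by
    have := congrArg (fun y : Site 2 L => y - x) h
    simpa using this.symm
  have h2 : ((n : ℕ) : ZMod L) = 0 := by
    have := congrFun h1 a
    simpa using this
  rw [ZMod.natCast_eq_zero_iff] at h2
  exact absurd (Nat.le_of_dvd hn0 h2) (by omega)

/-- **(U′) IS FALSE IN TWO DIMENSIONS** (`U(1)`, every `β ≥ 0`, every cut width `R`, every plane `i ≠ j`, every
axis `a`): `¬ CrossCutCorrelatorFloor 2 1 U(1) u1Rep β R i j a`. [folklore] -/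
theorem not_crossCutCorrelatorFloor_two_u1 {β : ℝ} (hβ : 0 ≤ β) (R : ℕ) {i j : Fin 2} (hij : i ≠ j)
    (a : Fin 2) : ¬ Conjectures.CrossCutCorrelatorFloor 2 1 Circle u1Rep β R i j a := by
  rintro ⟨δ, hδ, L₀, h⟩
  obtain ⟨L, hLt, hLge⟩ := (((tendsto_u1_covFactor β).eventually (gt_mem_nhds hδ)).and
    (eventually_ge_atTop (max L₀ (max 3 (2 * R + 2))))).exists
  have hL0 : L₀ ≤ L := le_trans (le_max_left _ _) hLge
  have hL3 : 3 ≤ L := le_trans (le_trans (le_max_left _ _) (le_max_right _ _)) hLge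
  have hLR : 2 * R + 2 ≤ L := le_trans (le_trans (le_max_right _ _) (le_max_right _ _)) hLge
  haveI : NeZero L := ⟨by omega⟩
  set x : Site 2 L := 0
  have hxx' : x ≠ x + Pi.single a (((2 * R + 1 : ℕ)) : ZMod L) := ne_add_single x a (by omega) (by omega)
  have hδle := h L hL0 x
  simp only [u1_plaqObs_re_eq hij] at hδle
  have hcov := u1_abs_cov_plaquette_pair_le hL3 hβ hxx' measurable_circle_re measurable_circle_re
    abs_circle_re_le_one abs_circle_re_le_one
  linarith

/-- **(U″) IS FALSE IN TWO DIMENSIONS** (`U(1)`, every `β ≥ 0`, every plane `i ≠ j`, every axis `a`):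
`¬ ClusteringFloor 2 1 U(1) u1Rep β i j a` (already the separation `s = 1` fails). [folklore] -/
theorem not_clusteringFloor_two_u1 {β : ℝ} (hβ : 0 ≤ β) {i j : Fin 2} (hij : i ≠ j) (a : Fin 2) :
    ¬ Conjectures.ClusteringFloor 2 1 Circle u1Rep β i j a := by
  rintro ⟨κ₀, hκ₀, ξ, hξ, L₀, h⟩
  have hδ : 0 < κ₀ * Real.exp (-(((1 : ℕ) : ℝ) / ξ)) := mul_pos hκ₀ (Real.exp_pos _)
  obtain ⟨L, hLt, hLge⟩ := (((tendsto_u1_covFactor β).eventually (gt_mem_nhds hδ)).and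
    (eventually_ge_atTop (max L₀ 4))).exists
  have hL0 : L₀ ≤ L := le_trans (le_max_left _ _) hLge
  have hL4 : 4 ≤ L := le_trans (le_max_right _ _) hLge
  haveI : NeZero L := ⟨by omega⟩
  set x : Site 2 L := 0
  have hxx' : x ≠ x + Pi.single a (((1 : ℕ)) : ZMod L) := ne_add_single x a (by omega) (by omega)
  have hδle := h L hL0 1 (by omega) x
  simp only [u1_plaqObs_re_eq hij] at hδle
  have hcov := u1_abs_cov_plaquette_pair_le (by omega : 3 ≤ L) hβ hxx' measurable_circle_re
    measurable_circle_re abs_circle_re_le_one abs_circle_re_le_one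
  linarith

/-- `U(1)` has a non-constant character: `Re(−1) = −1 ≠ 1`. [folklore] -/
theorem exists_u1_trace_re_ne : ∃ g : Circle, (u1Rep g).trace.re ≠ ((1 : ℕ) : ℝ) :=
  ⟨Circle.exp Real.pi, by
    rw [trace_u1Rep_re, Circle.coe_exp, Complex.exp_ofReal_mul_I_re, Real.cos_pi]; norm_num⟩

/-- **THE DIMENSION GUARD OF THE REPAIRED ITEM IS NECESSARY**: with every OTHER guard of
`ConjecturesRepaired.CrossCutCorrelatorFloorR` in force (`i ≠ j`, `0 < β`, non-constant character) the cross-cut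
floor still fails in `d = 2` (`U(1)`, every `β > 0`, `R`, `i ≠ j`, `a`). [folklore] -/
theorem not_crossCutCorrelatorFloorR_two_u1_unguarded {β : ℝ} (hβ : 0 < β) (R : ℕ) {i j : Fin 2}
    (hij : i ≠ j) (a : Fin 2) :
    ¬ (i ≠ j → 0 < β → (∃ g : Circle, (u1Rep g).trace.re ≠ ((1 : ℕ) : ℝ)) →
        Conjectures.CrossCutCorrelatorFloor 2 1 Circle u1Rep β R i j a) :=
  fun h => not_crossCutCorrelatorFloor_two_u1 hβ.le R hij a (h hij hβ exists_u1_trace_re_ne)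

/-- The same for the clustering floor: dropping only `3 ≤ d` from `ConjecturesRepaired.ClusteringFloorR` gives a
FALSE statement in `d = 2` (`U(1)`, every `β > 0`, `i ≠ j`, `a`). [folklore] -/
theorem not_clusteringFloorR_two_u1_unguarded {β : ℝ} (hβ : 0 < β) {i j : Fin 2} (hij : i ≠ j) (a : Fin 2) :
    ¬ (i ≠ j → 0 < β → (∃ g : Circle, (u1Rep g).trace.re ≠ ((1 : ℕ) : ℝ)) →
        Conjectures.ClusteringFloor 2 1 Circle u1Rep β i j a) :=
  fun h => not_clusteringFloor_two_u1 hβ.le hij a (h hij hβ exists_u1_trace_re_ne)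

/-- By contrast the repaired items themselves hold (vacuously) in `d = 2`: their guard `3 ≤ d` is exactly what
separates them from the false unguarded statements above. [folklore] -/
theorem crossCutCorrelatorFloorR_two (β : ℝ) (R : ℕ) (i j a : Fin 2) :
    Conjectures.CrossCutCorrelatorFloorR 2 1 Circle u1Rep β R i j a :=
  fun hd => absurd hd (by norm_num)

end U1

end Summit.Ventures.LatticeQCDFlow.Theory2.Lattice.TwoDim

end
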